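import Summits.Ventures.YMGap.RobustBall.TranslateAverageDLR
import Summits.Ventures.YMGap.RobustBall.ThermodynamicVariance
import Summits.Ventures.YMGap.RobustBall.UniformPlaquetteCorrFn
import Summits.Ventures.YMGap.Thresholds.ZeroCouplingResampling
import HarnessLib

/-!
# Robust ball (Y2) — AN EXPLICIT SUSCEPTIBILITY BOUND FROM THE HEAT-BATH GAP: the static susceptibility (= CLT variance) of every gauge-invariant local
# observable of strong-coupling `SU(2)` lattice Yang–Mills is at most `‖δ‖₁²/(2 − 9β_W)`

HONEST FRAMING: venture file of the cell `pub-ymgap` (QuantumFields programme), track ROBUST-BALL, seat rb-p2 (g15); a corollary of two tree theorems —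
`HeatBathConcentration.su2_gibbs_variance_translateAverage_le` (g14: the variance of the translate average `A_B = |B|⁻¹ ∑_{x∈B} F∘θ_x` in EVERY DLR state is
`≤ ‖δ‖₁²/((2 − 9β_W)|B|)`, from the Gibbs-state heat-bath Poincaré inequality) and ds-3's `su2_wilson_tendsto_variance_boxSum_div` (the thermodynamic fluctuation
density `Var_μ(∑_{x∈B_n} F∘θ_x)/#B_n` of a gauge-invariant local observable CONVERGES to its static susceptibility `χ(F) = ∑_{v∈ℤ⁴} Cov_μ(F, F∘θ_v)`, which is
absolutely summable).  LATTICE statements at STRONG COUPLING, Wilson action (class K); nothing about `β → ∞`, the continuum or Clay.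

THE STATEMENT.  GENERIC `gibbs_susceptibility_le_of_oneLinkKRModulus` (every `SU(N)`, every `d`, KR window; translation invariance of the state and absolute
summability of the autocovariance as hypotheses): `χ(F) ≤ (2(1−c))⁻¹‖δ‖₁²`.  ★★ `su2_gibbs_susceptibility_le`: `SU(2)`, `d = 4`, EVERY `0 ≤ β_W < 2/9` (tree coupling `β_W/2`), `μ` the (unique) DLR state, `F` any
GAUGE-INVARIANT Lipschitz cylinder observable on the finite link set `Δ` with link-oscillation profile `δ ≥ 0` supported in `Δ`:
`χ(F) := ∑_{v∈ℤ⁴} Cov_μ(F, F∘θ_v) ≤ ‖δ‖₁²/(2 − 9β_W)` — an EXPLICIT bound on the static susceptibility (the variance of the Gaussian limit in ds-3's CLT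
`BoxSumCLTSU2`), depending on `F` only through the `ℓ¹` norm of its link oscillations and on `β` only through the heat-bath gap `1 − 9β_W/2`; the tree's earlier
susceptibility bounds (`PlaquetteSusceptibility`, `KernelSusceptibility`, `UniformPlaquetteSusceptibility`) are existence statements with constants built from the
clustering rate `m` (of size `~ m^{−4}`).  ★★ `su2_gibbs_plaquette_susceptibility_le`: the plaquette `W_p = ½ Re tr U_p` (`‖δ‖₁ ≤ 8`):
`∑_{v∈ℤ⁴} Cov_μ(W_p, W_{p+v}) ≤ 64/(2 − 9β_W)` (`= 32` at `β = 0`, where the true value is `Var(W_p) = 1/4`; the bound is an a-priori strong-coupling estimate, not sharp).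
Mechanism: `Var_μ(∑_{x∈B_n} F∘θ_x)/#B_n = #B_n · Var_μ(A_{B_n}) ≤ ‖δ‖₁²/(2 − 9β_W)` for every `n`, and the left side tends to `χ(F)`.  0 sorry, 0 definitions.
References: L. Wu, Ann. Probab. 34 (2006) 1960 (Poincaré under Dobrushin); B. Simon, The Statistical Mechanics of Lattice Gases I (1993) §II.12.
Everything here is proved. [folklore]
-/

noncomputable section

open MeasureTheory Function Real Finset ProbabilityTheory Filter Topology
open scoped NNReal
open Literature.Probability.LatticeModels hiding configShift configShift_apply
open Literature.MathematicalPhysics.QuantumLattice hiding torusNorm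
open Literature.MathematicalPhysics.QuantumFieldTheory hiding ZdEdge Site IsLocalObservable
open Literature.MathematicalPhysics.QuantumFieldTheory.Balaban1983to89.StrongCouplingDobrushinWindow (OneLinkKRModulus)

namespace Summit.Ventures.YMGap.RobustBall.HeatBathConcentration


/-- ★★ **GENERIC FORM** (every `SU(N)`, every `d ≥ 1`, KR window `OneLinkKRModulus N R K`, `R ≥ 2(d−1)|β|`, `6(d−1)|β|K ≤ c < 1`): if the DLR state `μ` is translation
invariant and the autocovariance `v ↦ Cov_μ(F, F∘θ_v)` of the Lipschitz cylinder `F` (link-oscillation profile `δ ≥ 0` supported in `Δ`) is absolutely summable, then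
its static susceptibility obeys `∑_v Cov_μ(F, F∘θ_v) ≤ (2(1−c))⁻¹ (∑_{e∈Δ} δ_e)²` — the translate-average variance bound of the Gibbs-state Poincaré inequality passed
to the thermodynamic limit (`ThermodynamicVariance.tendsto_variance_boxSum_div`). [folklore] -/
theorem gibbs_susceptibility_le_of_oneLinkKRModulus {d N : ℕ} (hd : 1 ≤ d) (hN : 1 ≤ N) {β R K c : ℝ} (hK : 0 ≤ K)
    (hR : |β| * (2 * ((d : ℝ) - 1)) ≤ R) (hmod : OneLinkKRModulus N R K) (hc : 6 * ((d : ℝ) - 1) * |β| * K ≤ c) (hc1 : c < 1)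
    {μ : Measure (LGConfig d (Matrix.specialUnitaryGroup (Fin N) ℂ))}
    (hμ : μ ∈ ymGibbsMeasures (d := d) (fundamentalRep (Fin N)) (N * β)) (hinv : IsZdTranslationInvariant μ)
    {F : LGConfig d (Matrix.specialUnitaryGroup (Fin N) ℂ) → ℝ} {Δ : Finset (ZdEdge d)} {KF : ℝ≥0}
    (hF : IsLipschitzCylinder (fundamentalRep (Fin N)) F Δ KF)
    {δ : ZdEdge d → ℝ} (hδ0 : ∀ e, 0 ≤ δ e) (hδΔ : ∀ e, e ∉ Δ → δ e = 0) (hδ : ∀ e U s, |F U - F (update U e s)| ≤ δ e)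
    (hsum : Summable (fun v : Site d => |cov[F, fun U => F (configShift v U); μ]|)) :
    ∑' v : Site d, cov[F, fun U => F (configShift v U); μ] ≤ (2 * (1 - c))⁻¹ * (∑ e ∈ Δ, δ e) ^ 2 := by
  have hμ' : IsGibbsMeasure (ymSpecification (d := d) (fundamentalRep (Fin N)) (N * β)) μ := hμ
  haveI := hμ'.isProbabilityMeasure
  have htend := ThermodynamicVariance.tendsto_variance_boxSum_div hinv hF.measurable hF.abs_le hsum
  refine le_of_tendsto' htend fun n => ?_
  have hBne : (siteBox d n).Nonempty := Finset.card_pos.1 (by rw [ThermodynamicVariance.card_siteBox]; positivity)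
  have hBpos : (0 : ℝ) < (siteBox d n).card := by exact_mod_cast hBne.card_pos
  have hA := gibbs_variance_translateAverage_le_of_oneLinkKRModulus hd hN hK hR hmod hc hc1 hμ hF hδ0 hδΔ hδ hBne
  have hscale : Var[fun U => ∑ x ∈ siteBox d n, F (configShift x U); μ] =
      ((siteBox d n).card : ℝ) ^ 2 * Var[fun U => ((siteBox d n).card : ℝ)⁻¹ * ∑ x ∈ siteBox d n, F (configShift x U); μ] := by
    rw [variance_const_mul, ← mul_assoc, ← mul_pow, mul_inv_cancel₀ hBpos.ne', one_pow, one_mul]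
  rw [hscale]
  have hc0 : 0 < 2 * (1 - c) := by linarith
  calc ((siteBox d n).card : ℝ) ^ 2 * Var[fun U => ((siteBox d n).card : ℝ)⁻¹ * ∑ x ∈ siteBox d n, F (configShift x U); μ] / (siteBox d n).card
      = (siteBox d n).card * Var[fun U => ((siteBox d n).card : ℝ)⁻¹ * ∑ x ∈ siteBox d n, F (configShift x U); μ] := by
        field_simp
    _ ≤ (siteBox d n).card * ((2 * (1 - c))⁻¹ * ((∑ e ∈ Δ, δ e) ^ 2 / (siteBox d n).card)) := mul_le_mul_of_nonneg_left hA hBpos.le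
    _ = (2 * (1 - c))⁻¹ * (∑ e ∈ Δ, δ e) ^ 2 := by field_simp

/-- ★★ **THE STATIC SUSCEPTIBILITY OF EVERY GAUGE-INVARIANT LOCAL LIPSCHITZ OBSERVABLE IS AT MOST `‖δ‖₁²/(2 − 9β_W)`** (`SU(2)`, `d = 4`, `0 ≤ β_W < 2/9`,
tree coupling `β_W/2`): for every DLR state `μ` (there is exactly one), every gauge-invariant Lipschitz cylinder `F` on `Δ` with link oscillations
`|F(U) − F(U[e ↦ s])| ≤ δ_e` (`δ ≥ 0`, `δ = 0` off `Δ`): `v ↦ |Cov_μ(F, F∘θ_v)|` is summable over `ℤ⁴` and `∑_v Cov_μ(F, F∘θ_v) ≤ (∑_{e∈Δ} δ_e)²/(2 − 9β_W)`. [folklore] -/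
theorem su2_gibbs_susceptibility_le {βW : ℝ} (h0 : 0 ≤ βW) (h : βW < 2 / 9)
    {μ : Measure (LGConfig 4 (Matrix.specialUnitaryGroup (Fin 2) ℂ))}
    (hμ : μ ∈ ymGibbsMeasures (d := 4) (fundamentalRep (Fin 2)) (βW / 2))
    {F : LGConfig 4 (Matrix.specialUnitaryGroup (Fin 2) ℂ) → ℝ} {Δ : Finset (ZdEdge 4)} {KF : ℝ≥0}
    (hF : IsLipschitzCylinder (fundamentalRep (Fin 2)) F Δ KF) (hFg : IsZdGaugeInvariant F)
    {δ : ZdEdge 4 → ℝ} (hδ0 : ∀ e, 0 ≤ δ e) (hδΔ : ∀ e, e ∉ Δ → δ e = 0) (hδ : ∀ e U s, |F U - F (update U e s)| ≤ δ e) :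
    Summable (fun v : Site 4 => |cov[F, fun U => F (configShift v U); μ]|) ∧
      ∑' v : Site 4, cov[F, fun U => F (configShift v U); μ] ≤ (∑ e ∈ Δ, δ e) ^ 2 / (2 - 9 * βW) := by
  have hb : |βW / 2| ≤ 9 / 50 := by rw [abs_of_nonneg (by positivity)]; linarith
  obtain ⟨μ₀, hG, hall⟩ := ThermodynamicVariance.su2_wilson_tendsto_variance_boxSum_div hb
  have hμeq : μ = μ₀ := by rw [hG] at hμ; exact Set.mem_singleton_iff.1 hμ
  subst hμeq
  have hμ' : IsGibbsMeasure (ymSpecification (d := 4) (fundamentalRep (Fin 2)) (βW / 2)) μ := hμ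
  haveI := hμ'.isProbabilityMeasure
  have hloc : Literature.MathematicalPhysics.QuantumLattice.IsLocalObservable F := ⟨Δ, hF.isCylinder⟩
  obtain ⟨hs, htend⟩ := hall F hloc hF.measurable ⟨|F 1| + 2 * KF, hF.abs_le⟩ hFg
  refine ⟨hs, le_of_tendsto' htend fun n => ?_⟩
  -- for every box: `Var(S_n)/#B_n = #B_n · Var(A_{B_n}) ≤ ‖δ‖₁²/(2 − 9β_W)`
  have hBne : (siteBox 4 n).Nonempty := Finset.card_pos.1 (by rw [ThermodynamicVariance.card_siteBox]; positivity)
  have hBpos : (0 : ℝ) < (siteBox 4 n).card := by exact_mod_cast hBne.card_pos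
  have hA := su2_gibbs_variance_translateAverage_le h0 h hμ hF hδ0 hδΔ hδ hBne
  have hscale : Var[fun U => ∑ x ∈ siteBox 4 n, F (configShift x U); μ] =
      ((siteBox 4 n).card : ℝ) ^ 2 * Var[fun U => ((siteBox 4 n).card : ℝ)⁻¹ * ∑ x ∈ siteBox 4 n, F (configShift x U); μ] := by
    rw [variance_const_mul, ← mul_assoc, ← mul_pow, mul_inv_cancel₀ hBpos.ne', one_pow, one_mul]
  rw [hscale]
  have hc0 : 0 < 2 - 9 * βW := by linarith
  calc ((siteBox 4 n).card : ℝ) ^ 2 * Var[fun U => ((siteBox 4 n).card : ℝ)⁻¹ * ∑ x ∈ siteBox 4 n, F (configShift x U); μ] / (siteBox 4 n).card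
      = (siteBox 4 n).card * Var[fun U => ((siteBox 4 n).card : ℝ)⁻¹ * ∑ x ∈ siteBox 4 n, F (configShift x U); μ] := by
        field_simp
    _ ≤ (siteBox 4 n).card * ((∑ e ∈ Δ, δ e) ^ 2 / ((2 - 9 * βW) * (siteBox 4 n).card)) := mul_le_mul_of_nonneg_left hA hBpos.le
    _ = (∑ e ∈ Δ, δ e) ^ 2 / (2 - 9 * βW) := by field_simp

/-- The plaquette observable `W_p = (1/N) Re tr U_p` is gauge invariant. [folklore] -/
theorem isZdGaugeInvariant_zdPlaquetteObs {d N : ℕ} (hN : 1 ≤ N) (p : ZdPlaquette d) :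
    IsZdGaugeInvariant (zdPlaquetteObs (d := d) (fundamentalRep (Fin N)) p.1 p.2.1.1 p.2.1.2) := by
  intro g U
  have hN0 : (N : ℝ) ≠ 0 := by exact_mod_cast (show N ≠ 0 by omega)
  have h1 := plaquetteObs_eq_mul_zdPlaquetteObs hN p.1 p.2.1.1 p.2.1.2 (gaugeTransformZd g U)
  have h2 := plaquetteObs_eq_mul_zdPlaquetteObs hN p.1 p.2.1.1 p.2.1.2 U
  have h3 := isZdGaugeInvariant_plaquetteObs (fundamentalRep (Fin N)) p.1 p.2.1.1 p.2.1.2 g U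
  rw [h1, h2] at h3
  exact mul_left_cancel₀ hN0 h3

/-- ★★ **THE PLAQUETTE SUSCEPTIBILITY IS AT MOST `64/(2 − 9β_W)`** (`SU(2)`, `d = 4`, `0 ≤ β_W < 2/9`, tree coupling `β_W/2`, `W_p = ½ Re tr U_p`): for every DLR
state `μ` and every plaquette `p`, `v ↦ |Cov_μ(W_p, W_p∘θ_v)|` is summable and `∑_{v∈ℤ⁴} Cov_μ(W_p, W_p∘θ_v) ≤ 64/(2 − 9β_W)`. [folklore] -/
theorem su2_gibbs_plaquette_susceptibility_le {βW : ℝ} (h0 : 0 ≤ βW) (h : βW < 2 / 9)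
    {μ : Measure (LGConfig 4 (Matrix.specialUnitaryGroup (Fin 2) ℂ))}
    (hμ : μ ∈ ymGibbsMeasures (d := 4) (fundamentalRep (Fin 2)) (βW / 2)) (p : ZdPlaquette 4) :
    Summable (fun v : Site 4 => |cov[zdPlaquetteObs (d := 4) (fundamentalRep (Fin 2)) p.1 p.2.1.1 p.2.1.2,
        fun U => zdPlaquetteObs (d := 4) (fundamentalRep (Fin 2)) p.1 p.2.1.1 p.2.1.2 (configShift v U); μ]|) ∧
      ∑' v : Site 4, cov[zdPlaquetteObs (d := 4) (fundamentalRep (Fin 2)) p.1 p.2.1.1 p.2.1.2,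
        fun U => zdPlaquetteObs (d := 4) (fundamentalRep (Fin 2)) p.1 p.2.1.1 p.2.1.2 (configShift v U); μ] ≤ 64 / (2 - 9 * βW) := by
  classical
  have hL := isLipschitzCylinder_zdPlaquetteObs (N := 2) (d := 4) p.1 (i := p.2.1.1) (j := p.2.1.2) p.2.2
  set δ : ZdEdge 4 → ℝ := fun e => if e ∈ plaquetteEdges p then 2 else 0 with hδdef
  have hδ0 : ∀ e, 0 ≤ δ e := fun e => by simp only [hδdef]; split_ifs <;> norm_num
  have hδΔ : ∀ e, e ∉ plaquetteEdges p → δ e = 0 := fun e he => by simp [hδdef, he]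
  have hδ : ∀ e U s, |zdPlaquetteObs (d := 4) (fundamentalRep (Fin 2)) p.1 p.2.1.1 p.2.1.2 U -
      zdPlaquetteObs (d := 4) (fundamentalRep (Fin 2)) p.1 p.2.1.1 p.2.1.2 (update U e s)| ≤ δ e := by
    intro e U s
    by_cases he : e ∈ plaquetteEdges p
    · simp only [hδdef, he, if_true]
      calc _ ≤ |zdPlaquetteObs (d := 4) (fundamentalRep (Fin 2)) p.1 p.2.1.1 p.2.1.2 U| +
            |zdPlaquetteObs (d := 4) (fundamentalRep (Fin 2)) p.1 p.2.1.1 p.2.1.2 (update U e s)| := abs_sub _ _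
        _ ≤ 1 + 1 := add_le_add (abs_plaquetteObs_le_one p U) (abs_plaquetteObs_le_one p _)
        _ = 2 := by norm_num
    · simp only [hδdef, he, if_false]
      rw [ZeroCouplingMoments.zdPlaquetteObs_update_of_not_mem (fundamentalRep (Fin 2)) he U s, sub_self, abs_zero]
  have key := su2_gibbs_susceptibility_le h0 h hμ hL (isZdGaugeInvariant_zdPlaquetteObs (d := 4) (N := 2) (by norm_num) p) hδ0 hδΔ hδ
  refine ⟨key.1, key.2.trans ?_⟩
  have hc0 : 0 < 2 - 9 * βW := by linarith
  have hsum : ∑ e ∈ plaquetteEdges p, δ e ≤ 8 := by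
    have h1 : ∑ e ∈ plaquetteEdges p, δ e = 2 * (plaquetteEdges p).card := by
      rw [Finset.sum_congr rfl fun e (he : e ∈ plaquetteEdges p) => show δ e = 2 by simp [hδdef, he], Finset.sum_const, nsmul_eq_mul, mul_comm]
    rw [h1]
    have h2 : ((plaquetteEdges p).card : ℝ) ≤ 4 := by exact_mod_cast card_plaquetteEdges_le p
    linarith
  have hsum0 : 0 ≤ ∑ e ∈ plaquetteEdges p, δ e := Finset.sum_nonneg fun e _ => hδ0 e
  have hsq : (∑ e ∈ plaquetteEdges p, δ e) ^ 2 ≤ 64 := by nlinarith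
  exact div_le_div_of_nonneg_right hsq hc0.le

end Summit.Ventures.YMGap.RobustBall.HeatBathConcentration

end
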